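import Mathlib.Data.Real.Basic
import Literature.InformationTheory.QuantumCodes.SymplecticCodes
import HarnessLib

/-!
# Locality bounds for stabilizer codes on Euclidean lattices (Bravyi–Terhal 2009; Bravyi–Poulin–Terhal 2010) — statements

Topic `Literature/InformationTheory/QuantumCodes` (venture QEC, cell `qec`, PARTITION v2 row 06 / D2.6; LADDER-QEC rung X1
«barriers: locality bounds (2D-local ⇒ `kd² = O(n)`, `d = O(√n)`)»). STATEMENTS FIRST: the two published theorems are
`[cite:]` NAMED FACTS `def … : Prop` (D-0014), never asserted; each carries a BARRIER block (technique_class / blocks /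
because / evasions_known / scope_caveats / status) so that it doubles as the X1 catalogue entry read by the census seats
(a code family that is NOT geometrically local — e.g. the bivariate-bicycle / two-block codes with their long-range
wrap-around checks — is exactly an «evasion» of these bounds, and a 2D-local family can never be a `kd²/n → ∞` record).

Vocabulary. Codes are ADDITIVE (stabilizer) codes in the binary symplectic language of `SymplecticCodes.lean`
(`SympVec n`, `sympWeight`, `IsAdditiveCode S k d` = «`S̄` self-orthogonal of dimension `n − k`, no vector of weight
`≤ d − 1` in `S̄⊥ ∖ S̄`», the MONOTONE reading «minimum distance at least `d`» — both facts below are UPPER bounds on `d`,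
for which this reading is the faithful and the stronger one). Geometry [BravyiTerhal2009, §1 p. 3]: «the physical
qubits live at vertices of a `D`-dimensional lattice `Λ = {1,…,L}^D` … there are `n = L^D` physical qubits … the support
of every generator `S_a` can be bounded by a hypercube with `r^D` vertices»; [BravyiPoulinTerhal2010, p. 1]: «a regular
square lattice of size `√n × √n` with open boundary conditions … the support of any projector `Π_a` can be covered by a
square block of size `w × w`». We index lattice sites by `Fin D → Fin L` and PLACE the `n` qubits on the sites by an
explicit bijection `e : Fin n ≃ (Fin D → Fin L)` (so `n = L^D` automatically); `InCube r c x` is membership of the site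
`x` in the axis-parallel hypercube with corner `c` and `r^D` vertices (open boundary conditions: the cube is read inside
`Λ`), `InCubePeriodic` the same on the torus `(ℤ/L)^D`; `IsCubeLocal e r v` says the Pauli class `v` is supported in
some such cube, and `HasLocalGenerators e r S` that the stabilizer space `S̄` is spanned by its `r`-local elements —
i.e. «`S = ⟨S_1,…,S_m⟩` with every generator supported in a hypercube with `r^D` vertices» (generating sets may be
over-complete, as in the source).

Contents: `sympSupport` (+ `card_sympSupport`), `InCube`, `InCubePeriodic`, `IsCubeLocal`, `IsCubeLocalPeriodic`,
`HasLocalGenerators`, `HasLocalGeneratorsPeriodic` (an open-boundary cube with corner `c` is contained in the periodic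
cube with the same corner, so open-boundary locality implies torus locality — the one-line proofs come with the
proofs file); named facts `BravyiTerhal2009_d_le_c_sqrt_n` (Thm. 1, open
boundary; in `D = 2`, `n = L²`, it reads `d ≤ r√n` — hence the PARTITION name), `BravyiTerhal2009_thm1_periodic` (Thm. 1
on the torus, with the range `L ≥ 2(r−1)²` under which the printed proof, Prop. 1, runs), `BravyiPoulinTerhal2010_kd2_le_cn`
(Eq. (1) `k ≤ c n/d²`, STABILIZER/qubit special case of the commuting-projector theorem).

Deliberately NOT here: the commuting-projector / qudit generality of [BravyiPoulinTerhal2010] (our vocabulary is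
stabilizer codes on qubits — `TODO(general form)` at the decl), its `D`-dimensional form `k ≤ c n/d^{2/(D−1)}` (Eq. (2),
«generalizing our techniques … yields» — no proof details in the Letter; PROVED for stabilizer codes, on the torus and
with open boundaries, in `LocalCodeTradeoffTorus.lean`: `BravyiPoulinTerhal2010_eq2_torus`, `BravyiPoulinTerhal2010_eq2`,
and the `D = 2` periodic `BravyiPoulinTerhal2010_kd2_le_cn_torus`; the classical Eq. (3) `k ≤ c n/√d` is
`LocalCodeTradeoffClassical.lean`), subsystem codes (explicitly excluded there — NOW TYPED downstream: the vocabulary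
`gaugeStabilizer` / `IsSubsystemCode` / `IsGaugeCorrectable` with the subsystem Cleaning Lemma in `SubsystemCodes.lean`;
Bravyi–Terhal's Thm. 1* `d ≤ rL^{D−1}` for local STABILIZER generators in `SubsystemCodeDistanceBound.lean` (open) and
`SubsystemCodeDistanceBoundPeriodic.lean` (torus); their Thm. 3 `d ≤ 3rL^{D−1}` for local GAUGE generators, with the
Restriction Lemma, in `SubsystemCodeGaugeLocalDistanceBound.lean`; Bravyi 2011's `kd = O(n)` and Haah–Preskill's
subsystem logical-operator tradeoff in `SubsystemCodeTradeoff.lean`), the energy-barrier Thms. 2 / 2* of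
[BravyiTerhal2009] (NOW PROVED: `LocalCodeEnergyBarrier.lean`, `SubsystemCodeEnergyBarrier.lean`), the logical-operator
tradeoff `d̃·d^{1/(D−1)} = O(n)` of Haah–Preskill 2012 (stabilizer case: `LocalCodeLogicalOperatorTradeoff.lean`),
Delfosse's `kd² ≤ C(log k)² n` for hyperbolic surface/colour codes (LIT-4-REGISTER §A3), and the conjecture «`d = O(L)`
in `D = 3`» (a conjecture, not Literature). ℕ-subtraction: `D − 1`, `r − 1` only under `1 ≤ D`, `1 ≤ r`.

References (read via `lit`; custody of locators qec-lit-4, `run/shared/lean/pub/qec/lit/LIT-4-REGISTER.md` §A):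
S. Bravyi, B. Terhal, *A no-go theorem for a two-dimensional self-correcting quantum memory based on stabilizer codes*,
New J. Phys. 11 (2009) 043029 = arXiv:0810.1983 [BravyiTerhal2009] (Thm. 1 §1.1; Lemma 1, Def. 1, Prop. 1 §5);
S. Bravyi, D. Poulin, B. Terhal, *Tradeoffs for reliable quantum information storage in 2D systems*, Phys. Rev. Lett.
104 (2010) 050503 = arXiv:0909.5200 [BravyiPoulinTerhal2010] (Eq. (1), Eq. (2), Lemmas 1–2, Cor. 1).
-/

namespace Literature.InformationTheory.QuantumCodes

open Finset

variable {n : ℕ}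

/-! ### Supports; hypercubes in `{1,…,L}^D`; locally generated stabilizer spaces -/

/-- The **support** of a Pauli class `(a|b)`: the qubits `i` with `aᵢ = 1` or `bᵢ = 1` (the non-identity tensor
positions of `X^a Z^b`); its cardinality is `sympWeight`. Column: definition.
[cite: CalderbankEtAl1998, §2 (printed p. 4: weight = number of coordinates with aᵢ or bᵢ nonzero)] -/
def sympSupport (v : SympVec n) : Finset (Fin n) := {i | v.1 i ≠ 0 ∨ v.2 i ≠ 0}

/-- `|supp (a|b)| = wt(a|b)` (definitional). [cite: CalderbankEtAl1998, §2 (printed p. 4)] -/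
theorem card_sympSupport (v : SympVec n) : #(sympSupport v) = sympWeight v := rfl

section Lattice

variable {D L : ℕ}

/-- **Hypercube with `r^D` vertices, open boundary.** The site `x ∈ Λ = {1,…,L}^D` (coordinates `Fin L`) lies in the
axis-parallel hypercube with lowest corner `c` and side `r`: `cᵢ ≤ xᵢ < cᵢ + r` in every direction `i` (the cube is
read inside `Λ`; near the boundary it has fewer than `r^D` sites). Column: definition.
[cite: BravyiTerhal2009, §1 p. 3 («the support of every generator S_a can be bounded by a hypercube with r^D vertices»)] -/
def InCube (r : ℕ) (c x : Fin D → Fin L) : Prop :=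
  ∀ i, (c i : ℕ) ≤ x i ∧ (x i : ℕ) < c i + r

/-- **Hypercube with `r^D` vertices, periodic boundary** (`Λ = (ℤ/L)^D`): `(xᵢ − cᵢ) mod L < r` in every direction
(`Fin L` subtraction is subtraction modulo `L`). Column: definition.
[cite: BravyiTerhal2009, §1 p. 3 (lattice «with open or periodic boundary conditions») and §5 Def. 1 (periodic case)] -/
def InCubePeriodic (r : ℕ) (c x : Fin D → Fin L) : Prop :=
  ∀ i, ((x i - c i : Fin L) : ℕ) < r

/-- The Pauli class `v` on the `n = L^D` qubits placed on `Λ` by `e` is **`r`-local (open boundary)**: its support is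
contained in some hypercube with `r^D` vertices. Column: definition.
[cite: BravyiTerhal2009, §1.1 Thm. 1 (hypothesis on the generators)] -/
def IsCubeLocal (e : Fin n ≃ (Fin D → Fin L)) (r : ℕ) (v : SympVec n) : Prop :=
  ∃ c : Fin D → Fin L, ∀ i ∈ sympSupport v, InCube r c (e i)

/-- The Pauli class `v` is **`r`-local on the torus** `(ℤ/L)^D`. Column: definition.
[cite: BravyiTerhal2009, §1.1 Thm. 1 («periodic … boundary conditions»)] -/
def IsCubeLocalPeriodic (e : Fin n ≃ (Fin D → Fin L)) (r : ℕ) (v : SympVec n) : Prop :=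
  ∃ c : Fin D → Fin L, ∀ i ∈ sympSupport v, InCubePeriodic r c (e i)

/-- **`S̄` has `r`-local generators (open boundary)**: the stabilizer space is spanned by its `r`-local elements, i.e.
`S = ⟨S_1,…,S_m⟩` for some (possibly over-complete) family of generators each supported in a hypercube with `r^D`
vertices. Column: definition.
[cite: BravyiTerhal2009, §1.1 Thm. 1 («Let S = ⟨S_1,…,S_m⟩ be a stabilizer code on … Λ = {1,…,L}^D. Suppose the support of any generator S_a can be bounded by a hypercube with r^D vertices.»)] -/
def HasLocalGenerators (e : Fin n ≃ (Fin D → Fin L)) (r : ℕ) (S : Submodule (ZMod 2) (SympVec n)) : Prop :=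
  S ≤ Submodule.span (ZMod 2) {v | v ∈ S ∧ IsCubeLocal e r v}

/-- **`S̄` has `r`-local generators on the torus** `(ℤ/L)^D`. Column: definition.
[cite: BravyiTerhal2009, §1.1 Thm. 1 («This bound holds for both periodic and open boundary conditions.»)] -/
def HasLocalGeneratorsPeriodic (e : Fin n ≃ (Fin D → Fin L)) (r : ℕ) (S : Submodule (ZMod 2) (SympVec n)) : Prop :=
  S ≤ Submodule.span (ZMod 2) {v | v ∈ S ∧ IsCubeLocalPeriodic e r v}

end Lattice

/-! ### Named facts -/

/-- **Bravyi–Terhal 2009, Theorem 1** (distance of geometrically local stabilizer codes). «Theorem 1. Let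
`S = ⟨S_1,…,S_m⟩` be a stabilizer code on a `D`-dimensional lattice `Λ = {1,…,L}^D`. Suppose the support of any
generator `S_a` can be bounded by a hypercube with `r^D` vertices. Then the distance of `S` satisfies `d ≤ r L^{D−1}`.
This bound holds for both periodic and open boundary conditions.» Typed for qubits placed bijectively on `{1,…,L}^D`
(`n = L^D`), open-boundary hypercubes, `D ≥ 1`, `r ≥ 1` (a hypercube has `r^D ≥ 1` vertices), and `k ≥ 1` (the printed
`d = min_{P ∈ C(S)∖S} |P|` is over the undetectable errors, which exist iff `k ≥ 1`); the conclusion bounds every `d`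
with «no logical of weight `< d`», i.e. the minimum distance. In `D = 2`, `n = L²`, it is `d ≤ r√n` (the PARTITION
name). The periodic reading is `BravyiTerhal2009_thm1_periodic`. Column: cited fact.

BARRIER
technique_class: geometric-locality, stabilizer-codes, euclidean-lattice, local-generators, distance-vs-length
blocks: any family of stabilizer codes with generators of bounded range `r` on `D`-dimensional cubic lattices whose distance grows faster than `L^{D−1} = n^{(D−1)/D}` — in `D = 1` no macroscopic distance at all («any stabilizer code on a 1D lattice fails to satisfy condition 1q»), in `D = 2` nothing beyond `d = O(√n)` (surface codes saturate it) [cite: BravyiTerhal2009, §1.1 Thm. 1 and the discussion after it].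
because: Cleaning Lemma (for any region `M` either a non-trivial logical operator lives inside `M` or every logical can be multiplied by generators meeting `M` to act trivially on `M`) applied to a partition of `Λ` into slabs of widths `r`, `r−1`: some slab of width `≤ r` supports a logical operator, of weight `≤ r L^{D−1}` [cite: BravyiTerhal2009, §5 Lemma 1, Def. 1, Prop. 1 and the proof of Thm. 1].
evasions_known: NON-local generators (long-range connectivity: general qLDPC codes, two-block / bivariate-bicycle codes with wrap-around long edges are outside the hypothesis); higher dimension (`D ≥ 3` allows `d ∼ L^{⌊D/2⌋}` for generalized toric codes; no code saturating `L^{D−1}` for `D ≥ 3` is known to the authors) [cite: BravyiTerhal2009, §1.1 (after Thm. 1)]; non-Euclidean (hyperbolic) geometry is a different lattice model (cf. Delfosse 2013, LIT-4-REGISTER §A3); subsystem codes have their own bound `d ≤ 3r L^{D−1}` (Thm. 3, not typed).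
scope_caveats: the printed proof runs through Prop. 1, stated «for any `L ≥ 2(r−1)²`» (it writes `L = a(r−1) + br` with `a + b` even); Theorem 1 itself is printed with no restriction on `L` and is typed so — for `L ≤ r` it is trivial (`d ≤ n ≤ r L^{D−1}`), and with OPEN boundaries the slab argument also runs for every `L` using narrower end slabs (our remark; qec-lit-4 register A1 (h2)); generators may be over-complete; qubits (local dimension 2) only.
status: published theorem; named fact, PROVED in the tree — `BravyiTerhal2009_d_le_c_sqrt_n_holds` (`LocalCodeDistanceBound.lean`, all `L`, pure `𝔽₂`-symplectic linear algebra, LIT-4-REGISTER §A1). [cite: BravyiTerhal2009, §1.1 Thm. 1 (p. 4)] -/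
def BravyiTerhal2009_d_le_c_sqrt_n : Prop :=
  ∀ (D L r n k d : ℕ) (e : Fin n ≃ (Fin D → Fin L)) (S : Submodule (ZMod 2) (SympVec n)),
    1 ≤ D → 1 ≤ r → HasLocalGenerators e r S → IsAdditiveCode S k d → 1 ≤ k →
      d ≤ r * L ^ (D - 1)

/-- **Bravyi–Terhal 2009, Theorem 1 — periodic boundary conditions**, in the range where the printed proof runs:
on the torus `(ℤ/L)^D` with every generator supported in a hypercube with `r^D` vertices taken modulo `L`, and
`L ≥ 2(r−1)²` («Proposition 1. Let `S = ⟨S_1,…,S_m⟩` be a stabilizer code on a lattice `Λ = {1,…,L}^D` with open or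
periodic boundary conditions. Suppose the support of any generator `S_a` can be covered by a hypercube with `r^D`
vertices. Then `d_1(S) ≤ r` for any `L ≥ 2(r−1)²`», whence `d ≤ r L^{D−1}` as in the proof of Thm. 1), `D, r, k ≥ 1`
as above. Column: cited fact.

BARRIER
technique_class: geometric-locality, stabilizer-codes, euclidean-lattice, periodic-boundary, local-generators
blocks: as `BravyiTerhal2009_d_le_c_sqrt_n`, for translation-invariant / toric layouts with `L ≥ 2(r−1)²` [cite: BravyiTerhal2009, §1.1 Thm. 1 («both periodic and open boundary conditions») and §5 Prop. 1].
because: as `BravyiTerhal2009_d_le_c_sqrt_n`; on the torus the slab partition needs an even number of slabs of widths `r`, `r−1`, i.e. `L = a(r−1) + br` with `a + b` even, which every `L ≥ 2(r−1)²` admits [cite: BravyiTerhal2009, §5 proof of Prop. 1].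
evasions_known: as `BravyiTerhal2009_d_le_c_sqrt_n`.
scope_caveats: Theorem 1 is printed WITHOUT the range `L ≥ 2(r−1)²`; the periodic reading is typed here only in the range covered by the printed argument (smaller tori: not typed; for `L ≤ r` trivial).
status: published theorem; named fact, PROVED in the tree — `BravyiTerhal2009_thm1_periodic_holds` (`LocalCodeDistanceBoundPeriodic.lean`, in the typed range `L ≥ 2(r−1)²`). [cite: BravyiTerhal2009, §1.1 Thm. 1 with §5 Prop. 1] -/
def BravyiTerhal2009_thm1_periodic : Prop :=
  ∀ (D L r n k d : ℕ) (e : Fin n ≃ (Fin D → Fin L)) (S : Submodule (ZMod 2) (SympVec n)),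
    1 ≤ D → 1 ≤ r → 2 * (r - 1) ^ 2 ≤ L → HasLocalGeneratorsPeriodic e r S → IsAdditiveCode S k d → 1 ≤ k →
      d ≤ r * L ^ (D - 1)

/-- **Bravyi–Poulin–Terhal 2010, the tradeoff `kd² = O(n)` in 2D** — stabilizer/qubit special case. Printed (for codes
whose code space is the common `+1` eigenspace of pairwise commuting projectors `Π_a` on `n` finite-dimensional particles
on a `√n × √n` square lattice with open boundary conditions, each `Π_a` supported in a `w × w` square): «Our main result
is an upper bound `k ≤ c n/d²` (1). Here `c` is a constant coefficient that depends only on locality of the projectors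
defining the codespace and dimension of the Hilbert space describing individual particles.» (Abstract: «It is shown
that `kd² = O(n)`».) Typed for STABILIZER codes on qubits (`Π_a = ½(1 + S_a)` has the support of the generator `S_a`,
local dimension `2`, so `c = c(w)`): for every range `w` there is `c > 0` such that every stabilizer code on the `L × L`
grid (`n = L²`) with `w`-local generators has `k d² ≤ c n` — for every `d` with no logical of weight `< d` (for `k = 0`
the inequality is empty of content, as in print). Column: cited fact.
-- TODO(general form): commuting-projector codes on qudits of local dimension q (c = c(w,q)); the D-dimensional form
-- «k ≤ c n/d^α, α = 2/(D−1)» [BravyiPoulinTerhal2010, Eq. (2)]; periodic boundary conditions («can be easily extended»).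

BARRIER
technique_class: geometric-locality, 2D, stabilizer-codes, commuting-projector-codes, rate-distance-tradeoff, euclidean-lattice
blocks: every 2D-local code family with `k d²/n → ∞` — in particular constant rate `k/n ≥ c₁ > 0` forces `d = O(1)`, and `k = O(1)` allows at most `d = O(√n)` (surface codes `kd² ∼ n` are optimal up to the constant); this is THE bar a «hardware-relevant 2D layout» record is measured against [cite: BravyiPoulinTerhal2010, Eq. (1) and the paragraph after it (p. 1)].
because: partition the lattice into `R × R` correctable blocks `A`, `B` separated by a thin region `C` with `|C| ∼ n/R²`; the entropic error-correction condition `S(M|M̄) = −S(M)` for `A` and for `B` gives `k = S(Λ) ≤ S(C) ≤ |C|`, and the Disentangling Lemma (a correctable region is disentangled from the rest by a unitary on its boundary) shows every `∼ d × d` block is correctable, `R ≥ d/(cw)` [cite: BravyiPoulinTerhal2010, Eqs. (5)–(8), Lemma 1 (Disentangling), Cor. 1, Lemma 2].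
evasions_known: NON-Euclidean geometry — surface codes on hyperbolic tilings have constant rate with `d ∼ log n` (Zémor; Delfosse's `kd² ≤ C(log k)² n` is the matching barrier there) and `d ∼ √n log n` with `k = 1` on some 4D arithmetic manifolds [cite: BravyiPoulinTerhal2010, p. 2 («the bound Eq. (1) can be violated for non-Euclidean geometry»)]; NON-local connectivity (qLDPC / two-block codes; long-range couplers) is outside the hypothesis; SUBSYSTEM codes are not covered by the printed proof [cite: BravyiPoulinTerhal2010, p. 2 («they do not include … quantum subsystem codes»)]; higher `D` weakens the exponent to `2/(D−1)` [cite: BravyiPoulinTerhal2010, Eq. (2)].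
scope_caveats: the constant `c = c(w, q)` is not made explicit in print; Letter-level proof (Lemmas 1–2, Cor. 1); Euclidean square lattice, open boundary; typed only for stabilizer codes on qubits (the printed theorem is more general: commuting projectors, qudits); no instantiation at a specific `n` is meaningful without the constant (PARTITION row 06 NOT).
status: published theorem (PRL); named fact, PROVED in the tree — `BravyiPoulinTerhal2010_kd2_le_cn_holds` (`LocalCodeTradeoff.lean`, `c(w) = 20736 (max w 2 − 1)⁴`); `D`-dimensional and torus forms in `LocalCodeTradeoffTorus.lean`. [cite: BravyiPoulinTerhal2010, Eq. (1) (p. 1) with the abstract («kd² = O(n)»)] -/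
def BravyiPoulinTerhal2010_kd2_le_cn : Prop :=
  ∀ w : ℕ, ∃ c : ℝ, 0 < c ∧
    ∀ (L n k d : ℕ) (e : Fin n ≃ (Fin 2 → Fin L)) (S : Submodule (ZMod 2) (SympVec n)),
      HasLocalGenerators e w S → IsAdditiveCode S k d → (k : ℝ) * (d : ℝ) ^ 2 ≤ c * n

end Literature.InformationTheory.QuantumCodes
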